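import Mathlib.Analysis.SpecialFunctions.Trigonometric.Bounds
import Mathlib.Tactic
import Literature.MathematicalPhysics.QuantumFieldTheory.Balaban1983to89.B5Prop11Leaves
import HarnessLib

/-!
# DAG node N07 — THE ROBUST ONE-LEVEL INEQUALITY (R1L) IN DISPLAY FORM: the alias sum of `(1 − Π f)²∕(Σ S)⁴` against the
# matched alias sum `Π f²∕(Σ S)²`, with an explicit constant, for every odd block side `n ≥ 3`, every dimension, every coarse momentum

Width seat `pub-ymgap-dag-n07-w7` (g6), count-neutral helper (`--supports … --as helper`); socket (S2) of the located (L4) road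
(HOME `pub-ymgap-dag-n07-w7/LOCATED-KPOS-MULTILEVEL.md` §3–§4).

WHY.  On one averaging level (torus tiled by `n`-cubes, block means `P`, centre sampling `Π`) this lineage proved the SHARP margin
`⟨f, (Π − P)Δ⁻²f⟩ ≥ 0` for block-constant `f` (g5 `…N07AliasSumMarginSharp`).  The localisation road to the multi-level point-feasibility
lemma (P)_D pairs a block-constant `f` with the solution of a NON-block-constant forcing `r` (the commutator residual of a cut-off), and
needs `|⟨f, (Π − P)Δ⁻²r⟩| ≤ √C·⟨f, Δ⁻²f⟩^{1∕2}·n²‖r‖` (R1L).  By Parseval and Cauchy–Schwarz in the alias index this is the per-frequency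
DISPLAY inequality typed here: with the Dirichlet ratio `F(θ,m) = sin((θ+2πm)∕2)∕(n·sin((θ+2πm)∕(2n)))` (`F(0,m) = δ_{m,0}`) and the
Laplacian symbol `S(θ,m) = 4n²sin²((θ+2πm)∕(2n))` (dag-n07-w5's letters `f`, `Sxir`; `|e^{i(p′+l)ηc₀} − conj u(p′+l)|² = (1 − Π_κ F)²`),
★★★ `aliasSum_robust_bound`:
`Σ_{m ∈ [0,n)^ι} (1 − Π_κ F(θ_κ,m_κ))² ∕ (Σ_κ S(θ_κ,m_κ))⁴ ≤ (π²∕4)^{|ι|}·(π⁴∕1024 + |ι|²π⁴n^{|ι|}∕64) · Σ_m (Π_κ F(θ_κ,m_κ))² ∕ (Σ_κ S(θ_κ,m_κ))²`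
for every finite index type `ι`, every `θ ∈ [0,2π)^ι` not identically `0`, every odd `n ≥ 3`.  The constant is crude (numerically the best
constant is `3.2e−3` for `|ι| = 1`, `5.2e−3` for `|ι| = 2` at `n = 3`, attained at `θ = π`); only its INDEPENDENCE of `θ` (hence of the coarse
torus) matters for the road.  Mechanism: split off the NEAREST alias `m*` (per coordinate: `m* = 0` for `θ ≤ π`, `m* = n−1` for `θ > π`, the
latter reduced to the former by `θ ↦ 2π − θ`, `n` odd): there `F ≥ 2∕π` (Jordan twice), `1 − F ≤ (π²∕32)·S` (`tan y ≥ y`, `cos y ≥ 1 − y²∕2`,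
Jordan) and `S ≤ π²`; every other alias has `S ≥ 4`; and `1 − Πa ≤ Σ(1 − a)` on `[0,1]`.
* §1 one-variable trigonometry: `mul_cos_le_sin`, `two_div_pi_mul_le_sin_of_mem`, `dirRatio_ge_cos`, `two_div_pi_le_dirRatio`,
  `one_sub_dirRatio_le`, `abs_dirRatio_le_one`;
* §2 the letters `dirF`, `symS` and the nearest ∕ far alias facts: `dirF_reflect`, `symS_reflect`, `nearestAlias_bounds`, `four_le_symS_of_ne`;
* §3 `one_sub_prod_le_sum`, ★★★ `aliasSum_robust_bound`.

HONEST SCOPE.  Elementary real analysis; asserts NOTHING about [B11]∕[B6]∕[3]; the x-space form of (R1L) (Parseval + dag-n07-w5's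
`dft_sample` ∕ `dft_QsOp_adjoint`), the regularity sockets (S3) and the assembly (S4)–(S5) of the road are NOT here; (P)_D for Bałaban's
`d = 4` geometries OPEN; `hker` at the record, stub 1, K0⁷ ∕ K1⁹ NOT closed; N07 not discharged; nothing continuum ∕ OS ∕ mass gap.
Context only (no hypothesis is a citation): T. Bałaban, CMP **95** (1984) 17–40 [Balaban1984PropagatorsI] (1.29)–(1.33); CMP **109** (1987)
249–301 [Balaban1987RG1] (0.4).

FILE SPLIT (400-line cap): this CORE file holds §1–§2 (one-variable trigonometry, the letters `dirF`∕`symS`, nearest∕far aliases);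
the sequel `…N07AliasSumRobustBound` holds §3 (`one_sub_prod_le_sum`, ★★★ `aliasSum_robust_bound`).
-/

set_option autoImplicit false

noncomputable section

open Finset Real

namespace Summit.QuantumFields.YangMills.Theorems.N07AliasSumRobustBound

open Literature.MathematicalPhysics.QuantumFieldTheory.Balaban1983to89.B5Prop11Leaves (abs_sin_nat_mul_le)

/-! ## §1  One-variable trigonometry on `[0, π∕2]` -/

/-- `y·cos y ≤ sin y` on `[0, π∕2]` (`tan y ≥ y`). [folklore] -/
theorem mul_cos_le_sin {y : ℝ} (h0 : 0 ≤ y) (h1 : y ≤ π / 2) : y * cos y ≤ sin y := by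
  rcases lt_or_eq_of_le h1 with hlt | heq
  · have hc : 0 < cos y := cos_pos_of_mem_Ioo ⟨by linarith [pi_pos], hlt⟩
    have ht := le_tan h0 hlt
    rw [tan_eq_sin_div_cos, le_div_iff₀ hc] at ht
    exact ht
  · subst heq; simp

/-- Jordan on a symmetric window: if `a ≤ x ≤ π − a` with `0 ≤ a` then `(2∕π)·a ≤ sin x`. [folklore] -/
theorem two_div_pi_mul_le_sin_of_mem {a x : ℝ} (ha0 : 0 ≤ a) (hx1 : a ≤ x) (hx2 : x ≤ π - a) :
    2 / π * a ≤ sin x := by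
  by_cases hx : x ≤ π / 2
  · calc 2 / π * a ≤ 2 / π * x := by gcongr
      _ ≤ sin x := mul_le_sin (le_trans ha0 hx1) hx
  · have hx' : π / 2 < x := lt_of_not_ge hx
    have h1 : 0 ≤ π - x := by linarith
    have h2 : π - x ≤ π / 2 := by linarith
    calc 2 / π * a ≤ 2 / π * (π - x) := mul_le_mul_of_nonneg_left (by linarith) (by positivity)
      _ ≤ sin (π - x) := mul_le_sin h1 h2
      _ = sin x := sin_pi_sub x

/-- The Dirichlet ratio dominates the cosine near the origin: for `n ≥ 1`, `0 < x`, `n·x ≤ π∕2`,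
`cos(nx) ≤ sin(nx)∕(n·sin x)`. [folklore] -/
theorem dirRatio_ge_cos {n : ℕ} (hn : 1 ≤ n) {x : ℝ} (hx0 : 0 < x) (hx1 : (n : ℝ) * x ≤ π / 2) :
    cos (n * x) ≤ sin (n * x) / (n * sin x) := by
  have hn0 : (0 : ℝ) < n := by exact_mod_cast (show 0 < n by omega)
  have hxpi : x < π := by
    have : x ≤ (n : ℝ) * x := le_mul_of_one_le_left hx0.le (by exact_mod_cast hn)
    linarith [pi_pos]
  have hs : 0 < sin x := sin_pos_of_pos_of_lt_pi hx0 hxpi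
  have hden : 0 < (n : ℝ) * sin x := mul_pos hn0 hs
  rw [le_div_iff₀ hden]
  have h1 : (n : ℝ) * x * cos (n * x) ≤ sin (n * x) := mul_cos_le_sin (by positivity) hx1
  have hc : 0 ≤ cos (n * x) := cos_nonneg_of_mem_Icc ⟨by linarith [pi_pos, mul_pos hn0 hx0], hx1⟩
  have h2 : sin x ≤ x := sin_le hx0.le
  calc cos (n * x) * (n * sin x) = n * sin x * cos (n * x) := by ring
    _ ≤ n * x * cos (n * x) := by gcongr
    _ ≤ sin (n * x) := h1

/-- Jordan for the Dirichlet ratio near the origin: `2∕π ≤ sin(nx)∕(n·sin x)` for `0 < x`, `n·x ≤ π∕2`. [folklore] -/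
theorem two_div_pi_le_dirRatio {n : ℕ} (hn : 1 ≤ n) {x : ℝ} (hx0 : 0 < x) (hx1 : (n : ℝ) * x ≤ π / 2) :
    2 / π ≤ sin (n * x) / (n * sin x) := by
  have hn0 : (0 : ℝ) < n := by exact_mod_cast (show 0 < n by omega)
  have hxpi : x < π := by
    have : x ≤ (n : ℝ) * x := le_mul_of_one_le_left hx0.le (by exact_mod_cast hn)
    linarith [pi_pos]
  have hs : 0 < sin x := sin_pos_of_pos_of_lt_pi hx0 hxpi
  have hden : 0 < (n : ℝ) * sin x := mul_pos hn0 hs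
  rw [le_div_iff₀ hden]
  have hj : 2 / π * (n * x) ≤ sin (n * x) := mul_le_sin (by positivity) hx1
  have h2 : sin x ≤ x := sin_le hx0.le
  have hp : 0 ≤ 2 / π := by positivity
  calc 2 / π * (n * sin x) ≤ 2 / π * (n * x) := by gcongr
    _ ≤ sin (n * x) := hj

/-- ★ The defect of the Dirichlet ratio by the Laplacian symbol: `1 − sin(nx)∕(n·sin x) ≤ (π²∕32)·4n²sin²x` for `0 < x`,
`n·x ≤ π∕2` (`1 − cos y ≤ y²∕2` and `y ≤ (π∕2)·sin y`). [folklore] -/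
theorem one_sub_dirRatio_le {n : ℕ} (hn : 1 ≤ n) {x : ℝ} (hx0 : 0 < x) (hx1 : (n : ℝ) * x ≤ π / 2) :
    1 - sin (n * x) / (n * sin x) ≤ π ^ 2 / 32 * (4 * (n : ℝ) ^ 2 * sin x ^ 2) := by
  have hn0 : (0 : ℝ) < n := by exact_mod_cast (show 0 < n by omega)
  have hc := dirRatio_ge_cos hn hx0 hx1
  have hcos : 1 - ((n : ℝ) * x) ^ 2 / 2 ≤ cos (n * x) := one_sub_sq_div_two_le_cos
  have hxle : x ≤ π / 2 := by
    have : x ≤ (n : ℝ) * x := le_mul_of_one_le_left hx0.le (by exact_mod_cast hn)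
    linarith
  have hj : 2 / π * x ≤ sin x := mul_le_sin hx0.le hxle
  have hx' : x ≤ π / 2 * sin x := by
    have hp : 0 < π := pi_pos
    have := mul_le_mul_of_nonneg_left hj (le_of_lt (by positivity : (0 : ℝ) < π / 2))
    calc x = π / 2 * (2 / π * x) := by field_simp
      _ ≤ π / 2 * sin x := this
  have hsq : x ^ 2 ≤ (π / 2 * sin x) ^ 2 := pow_le_pow_left₀ hx0.le hx' 2
  nlinarith [hsq, hc, hcos, sq_nonneg (n : ℝ)]

/-- `|sin(nx)∕(n·sin x)| ≤ 1` for `n ≥ 1` (from `|sin(nx)| ≤ n|sin x|`, the tree's `B5Prop11Leaves.abs_sin_nat_mul_le`). [folklore] -/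
theorem abs_dirRatio_le_one {n : ℕ} (hn : 1 ≤ n) (x : ℝ) : |sin (n * x) / (n * sin x)| ≤ 1 := by
  have h := abs_sin_nat_mul_le n x
  by_cases hs : sin x = 0
  · simp [hs]
  · have hn0 : (0 : ℝ) < n := by exact_mod_cast (show 0 < n by omega)
    have hpos : 0 < |(n : ℝ) * sin x| := by
      rw [abs_mul, abs_of_pos hn0]; exact mul_pos hn0 (abs_pos.mpr hs)
    rw [abs_div, div_le_one hpos, abs_mul, abs_of_pos hn0]
    exact h

/-! ## §2  The display letters and the nearest ∕ far aliases -/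

/-! THE LETTERS (no definitions are introduced; every statement below takes the two display letters as hypotheses
`hF : F = fun θ m => if θ = 0 then (if m = 0 then 1 else 0) else sin((θ+2πm)∕2)∕(n·sin((θ+2πm)∕(2n)))` — the Dirichlet
ratio with the zero-momentum convention `F(0,m) = δ_{m,0}` — and `hS : S = fun θ m => 4n²·sin²((θ+2πm)∕(2n))` — the Laplacian
symbol; a consumer instantiates them with `rfl`). -/

/-- `S ≥ 0`. [folklore] -/
theorem symS_nonneg (n : ℕ) (S : ℝ → ℕ → ℝ) (hS : S = fun (θ : ℝ) (m : ℕ) => 4 * (n : ℝ) ^ 2 * sin ((θ + 2 * π * (m : ℝ)) / (2 * (n : ℝ))) ^ 2) (θ : ℝ) (m : ℕ) :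
    0 ≤ S θ m := by
  subst hS; positivity

/-- `|F| ≤ 1` (for `n ≥ 1`). [folklore] -/
theorem abs_dirF_le_one {n : ℕ} (hn : 1 ≤ n) (F : ℝ → ℕ → ℝ)
    (hF : F = fun (θ : ℝ) (m : ℕ) => if θ = 0 then (if m = 0 then (1 : ℝ) else 0) else
      sin ((θ + 2 * π * (m : ℝ)) / 2) / ((n : ℝ) * sin ((θ + 2 * π * (m : ℝ)) / (2 * (n : ℝ))))) (θ : ℝ) (m : ℕ) :
    |F θ m| ≤ 1 := by
  subst hF
  dsimp only
  split_ifs with h1 h2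
  · simp
  · simp
  · have hn0 : (n : ℝ) ≠ 0 := by exact_mod_cast (show n ≠ 0 by omega)
    have e : (θ + 2 * π * m) / 2 = n * ((θ + 2 * π * m) / (2 * n)) := by field_simp
    rw [e]
    exact abs_dirRatio_le_one hn _

/-- The nearest alias at `θ ∈ (0, π]` is `m = 0`, with angle `x = θ∕(2n) ∈ (0, π∕(2n)]`: `F(θ,0) = sin(nx)∕(n sin x)`,
`S(θ,0) = 4n²sin²x`. [folklore] -/
theorem dirF_zero_eq {n : ℕ} (hn : 1 ≤ n) (F : ℝ → ℕ → ℝ)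
    (hF : F = fun (θ : ℝ) (m : ℕ) => if θ = 0 then (if m = 0 then (1 : ℝ) else 0) else
      sin ((θ + 2 * π * (m : ℝ)) / 2) / ((n : ℝ) * sin ((θ + 2 * π * (m : ℝ)) / (2 * (n : ℝ))))) {θ : ℝ} (hθ : θ ≠ 0) :
    F θ 0 = sin (n * (θ / (2 * n))) / (n * sin (θ / (2 * n))) := by
  have hn0 : (n : ℝ) ≠ 0 := by exact_mod_cast (show n ≠ 0 by omega)
  subst hF
  dsimp only
  rw [if_neg hθ]
  simp only [Nat.cast_zero, mul_zero, add_zero]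
  congr 2
  field_simp

/-- ★ Reflection of the LAST alias onto the first (odd `n`): `F(θ, n−1) = F(2π − θ, 0)` for `θ ∈ (0, 2π)`. [folklore] -/
theorem dirF_reflect {n : ℕ} (hn : Odd n) (h1 : 1 ≤ n) (F : ℝ → ℕ → ℝ)
    (hF : F = fun (θ : ℝ) (m : ℕ) => if θ = 0 then (if m = 0 then (1 : ℝ) else 0) else
      sin ((θ + 2 * π * (m : ℝ)) / 2) / ((n : ℝ) * sin ((θ + 2 * π * (m : ℝ)) / (2 * (n : ℝ))))) {θ : ℝ} (hθ0 : 0 < θ) (hθ1 : θ < 2 * π) :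
    F θ (n - 1) = F (2 * π - θ) 0 := by
  obtain ⟨k, hk⟩ := hn
  have hn0 : (n : ℝ) ≠ 0 := by exact_mod_cast (show n ≠ 0 by omega)
  have hθ : θ ≠ 0 := ne_of_gt hθ0
  have hφ : 2 * π - θ ≠ 0 := by linarith
  subst hF
  dsimp only
  rw [if_neg hθ, if_neg hφ]
  simp only [Nat.cast_zero, mul_zero, add_zero]
  have hcast : ((n - 1 : ℕ) : ℝ) = 2 * k := by
    rw [Nat.cast_sub h1, hk]; push_cast; ring
  rw [hcast]
  -- numerator: sin(θ/2 + 2kπ) = sin(θ/2) = sin((2π−θ)/2)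
  have e1 : sin ((θ + 2 * π * (2 * k)) / 2) = sin ((2 * π - θ) / 2) := by
    have : (θ + 2 * π * (2 * k)) / 2 = θ / 2 + (k : ℕ) * (2 * π) := by ring
    rw [this, sin_add_nat_mul_two_pi, show (2 * π - θ) / 2 = π - θ / 2 by ring, sin_pi_sub]
  -- denominator: (θ + 4kπ)/(2n) = π − (2π − θ)/(2n) since n = 2k+1
  have e2 : sin ((θ + 2 * π * (2 * k)) / (2 * n)) = sin ((2 * π - θ) / (2 * n)) := by
    have hnk : (n : ℝ) = 2 * k + 1 := by rw [hk]; push_cast; ring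
    have : (θ + 2 * π * (2 * k)) / (2 * n) = π - (2 * π - θ) / (2 * n) := by
      rw [hnk]; field_simp; ring
    rw [this, sin_pi_sub]
  rw [e1, e2]

/-- Reflection for the symbol: `S(θ, n−1) = S(2π − θ, 0)` (odd `n`). [folklore] -/
theorem symS_reflect {n : ℕ} (hn : Odd n) (h1 : 1 ≤ n) (S : ℝ → ℕ → ℝ) (hS : S = fun (θ : ℝ) (m : ℕ) => 4 * (n : ℝ) ^ 2 * sin ((θ + 2 * π * (m : ℝ)) / (2 * (n : ℝ))) ^ 2) (θ : ℝ) :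
    S θ (n - 1) = S (2 * π - θ) 0 := by
  obtain ⟨k, hk⟩ := hn
  subst hS
  dsimp only
  simp only [Nat.cast_zero, mul_zero, add_zero]
  have hcast : ((n - 1 : ℕ) : ℝ) = 2 * k := by
    rw [Nat.cast_sub h1, hk]; push_cast; ring
  rw [hcast]
  have hnk : (n : ℝ) = 2 * k + 1 := by rw [hk]; push_cast; ring
  have hn0 : (n : ℝ) ≠ 0 := by rw [hnk]; positivity
  have : (θ + 2 * π * (2 * k)) / (2 * n) = π - (2 * π - θ) / (2 * n) := by
    rw [hnk]; field_simp; ring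
  rw [this, sin_pi_sub]

/-- ★ **The nearest alias at `θ ∈ [0, π]`** (`m* = 0`): `2∕π ≤ F ≤ 1`, `1 − F ≤ (π²∕32)·S`, `S ≤ π²`, and `S > 0` unless `θ = 0`.
[folklore] -/
theorem nearestAlias_zero {n : ℕ} (hn : 1 ≤ n) (F : ℝ → ℕ → ℝ)
    (hF : F = fun (θ : ℝ) (m : ℕ) => if θ = 0 then (if m = 0 then (1 : ℝ) else 0) else
      sin ((θ + 2 * π * (m : ℝ)) / 2) / ((n : ℝ) * sin ((θ + 2 * π * (m : ℝ)) / (2 * (n : ℝ)))))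
    (S : ℝ → ℕ → ℝ) (hS : S = fun (θ : ℝ) (m : ℕ) => 4 * (n : ℝ) ^ 2 * sin ((θ + 2 * π * (m : ℝ)) / (2 * (n : ℝ))) ^ 2) {θ : ℝ} (hθ0 : 0 ≤ θ) (hθ1 : θ ≤ π) :
    2 / π ≤ F θ 0 ∧ F θ 0 ≤ 1 ∧ 1 - F θ 0 ≤ π ^ 2 / 32 * S θ 0 ∧ S θ 0 ≤ π ^ 2 ∧
      (θ ≠ 0 → 0 < S θ 0) := by
  have hn0 : (0 : ℝ) < n := by exact_mod_cast (show 0 < n by omega)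
  have hn1 : (1 : ℝ) ≤ n := by exact_mod_cast hn
  have hF1 : F θ 0 ≤ 1 := (abs_le.mp (abs_dirF_le_one hn F hF θ 0)).2
  have hS0 : S θ 0 = 4 * (n : ℝ) ^ 2 * sin (θ / (2 * n)) ^ 2 := by
    subst hS; simp
  -- the angle x = θ/(2n) ∈ [0, π/(2n)]
  set x : ℝ := θ / (2 * n) with hx
  have hx0 : 0 ≤ x := by positivity
  have hnx : (n : ℝ) * x = θ / 2 := by rw [hx]; field_simp
  have hx1 : (n : ℝ) * x ≤ π / 2 := by rw [hnx]; linarith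
  have hxle : x ≤ π / 2 := le_trans (le_mul_of_one_le_left hx0 hn1) hx1
  have hSpi : S θ 0 ≤ π ^ 2 := by
    rw [hS0]
    have h1 : sin x ≤ x := sin_le hx0
    have h2 : 0 ≤ sin x := sin_nonneg_of_nonneg_of_le_pi hx0 (by linarith [pi_pos])
    have h3 : sin x ^ 2 ≤ x ^ 2 := pow_le_pow_left₀ h2 h1 2
    have h4 : 4 * (n : ℝ) ^ 2 * x ^ 2 = θ ^ 2 := by rw [hx]; field_simp; ring
    have h5 : θ ^ 2 ≤ π ^ 2 := pow_le_pow_left₀ hθ0 hθ1 2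
    nlinarith [h3, sq_nonneg (n : ℝ)]
  by_cases hθ : θ = 0
  · subst hθ
    have hF0 : F 0 0 = 1 := by subst hF; simp
    refine ⟨?_, hF1, ?_, hSpi, fun h => (h rfl).elim⟩
    · rw [hF0]
      rw [div_le_one pi_pos]
      linarith [pi_gt_three]
    · rw [hF0, sub_self]
      exact mul_nonneg (by positivity) (symS_nonneg n S hS 0 0)
  · have hxpos : 0 < x := by
      rw [hx]; exact div_pos (lt_of_le_of_ne hθ0 (Ne.symm hθ)) (by positivity)
    have hF0 : F θ 0 = sin (n * x) / (n * sin x) := dirF_zero_eq hn F hF hθ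
    refine ⟨?_, hF1, ?_, hSpi, fun _ => ?_⟩
    · rw [hF0]; exact two_div_pi_le_dirRatio hn hxpos hx1
    · rw [hF0, hS0]; exact one_sub_dirRatio_le hn hxpos hx1
    · rw [hS0]
      have hxpi : x < π := by linarith [pi_pos]
      have := sin_pos_of_pos_of_lt_pi hxpos hxpi
      positivity

/-- ★ **The nearest alias at `θ ∈ (π, 2π)`** (`m* = n − 1`, odd `n`): the same four bounds, by reflection. [folklore] -/
theorem nearestAlias_last {n : ℕ} (hn : Odd n) (h1 : 1 ≤ n) (F : ℝ → ℕ → ℝ)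
    (hF : F = fun (θ : ℝ) (m : ℕ) => if θ = 0 then (if m = 0 then (1 : ℝ) else 0) else
      sin ((θ + 2 * π * (m : ℝ)) / 2) / ((n : ℝ) * sin ((θ + 2 * π * (m : ℝ)) / (2 * (n : ℝ)))))
    (S : ℝ → ℕ → ℝ) (hS : S = fun (θ : ℝ) (m : ℕ) => 4 * (n : ℝ) ^ 2 * sin ((θ + 2 * π * (m : ℝ)) / (2 * (n : ℝ))) ^ 2) {θ : ℝ} (hθ0 : π < θ) (hθ1 : θ < 2 * π) :
    2 / π ≤ F θ (n - 1) ∧ F θ (n - 1) ≤ 1 ∧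
      1 - F θ (n - 1) ≤ π ^ 2 / 32 * S θ (n - 1) ∧ S θ (n - 1) ≤ π ^ 2 ∧ 0 < S θ (n - 1) := by
  have hθpos : 0 < θ := lt_trans pi_pos hθ0
  rw [dirF_reflect hn h1 F hF hθpos hθ1, symS_reflect hn h1 S hS θ]
  have hφ0 : 0 ≤ 2 * π - θ := by linarith
  have hφ1 : 2 * π - θ ≤ π := by linarith
  obtain ⟨a, b, c, e, f⟩ := nearestAlias_zero h1 F hF S hS hφ0 hφ1
  exact ⟨a, b, c, e, f (by linarith)⟩

/-- ★ **Far aliases**: for `θ ∈ [0, 2π)` and `m < n` other than the nearest alias (`m ≠ 0` if `θ ≤ π`, `m ≠ n−1` if `θ > π`) the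
alias angle `(θ+2πm)∕(2n)` lies in `[π∕(2n), π − π∕(2n)]`, hence `S(θ,m) ≥ 4`. [folklore] -/
theorem four_le_symS_of_far {n : ℕ} (hn : 1 ≤ n) (S : ℝ → ℕ → ℝ) (hS : S = fun (θ : ℝ) (m : ℕ) => 4 * (n : ℝ) ^ 2 * sin ((θ + 2 * π * (m : ℝ)) / (2 * (n : ℝ))) ^ 2)
    {θ : ℝ} (hθ0 : 0 ≤ θ) (hθ1 : θ < 2 * π) {m : ℕ} (hm : m < n)
    (hfar : (θ ≤ π ∧ m ≠ 0) ∨ (π < θ ∧ m ≠ n - 1)) : 4 ≤ S θ m := by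
  have hn0 : (0 : ℝ) < n := by exact_mod_cast (show 0 < n by omega)
  set x : ℝ := (θ + 2 * π * m) / (2 * n) with hx
  -- the window
  have hwin : π / (2 * n) ≤ x ∧ x ≤ π - π / (2 * n) := by
    have h2n : (0 : ℝ) < 2 * n := by positivity
    have hup : (π - π / (2 * n)) = (2 * π * n - π) / (2 * n) := by field_simp
    rcases hfar with ⟨hθπ, hm0⟩ | ⟨hθπ, hmn⟩
    · have hm1 : (1 : ℝ) ≤ m := by exact_mod_cast Nat.one_le_iff_ne_zero.mpr hm0
      have hm2 : (m : ℝ) ≤ n - 1 := by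
        have : m ≤ n - 1 := by omega
        have h := (Nat.cast_le (α := ℝ)).mpr this
        rw [Nat.cast_sub hn] at h; simpa using h
      have hlo : π ≤ θ + 2 * π * m := by nlinarith [pi_pos, hm1, hθ0]
      have hhi : θ + 2 * π * m ≤ 2 * π * n - π := by
        have := mul_le_mul_of_nonneg_left hm2 (le_of_lt (by positivity : (0 : ℝ) < 2 * π))
        linarith
      constructor
      · rw [hx]; exact div_le_div_of_nonneg_right hlo h2n.le
      · rw [hx, hup]; exact div_le_div_of_nonneg_right hhi h2n.le
    · have hm2 : (m : ℝ) ≤ n - 2 := by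
        have : m ≤ n - 2 := by omega
        have h2 : 2 ≤ n := by omega
        have h := (Nat.cast_le (α := ℝ)).mpr this
        rw [Nat.cast_sub h2] at h; simpa using h
      have hm0 : (0 : ℝ) ≤ m := Nat.cast_nonneg m
      have hlo : π ≤ θ + 2 * π * m := by nlinarith [pi_pos, hm0, hθπ]
      have hhi : θ + 2 * π * m ≤ 2 * π * n - π := by
        have := mul_le_mul_of_nonneg_left hm2 (le_of_lt (by positivity : (0 : ℝ) < 2 * π))
        linarith
      constructor
      · rw [hx]; exact div_le_div_of_nonneg_right hlo h2n.le
      · rw [hx, hup]; exact div_le_div_of_nonneg_right hhi h2n.le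
  have ha0 : 0 ≤ π / (2 * n) := by positivity
  have hsin : 2 / π * (π / (2 * n)) ≤ sin x := two_div_pi_mul_le_sin_of_mem ha0 hwin.1 hwin.2
  have hsin' : 1 / n ≤ sin x := by
    have : 2 / π * (π / (2 * n)) = 1 / n := by field_simp
    rw [this] at hsin; exact hsin
  have hpos : 0 ≤ 1 / (n : ℝ) := by positivity
  have hsq : (1 / (n : ℝ)) ^ 2 ≤ sin x ^ 2 := pow_le_pow_left₀ hpos hsin' 2
  subst hS
  dsimp only
  rw [← hx]
  have e : 4 * (n : ℝ) ^ 2 * (1 / n) ^ 2 = 4 := by field_simp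
  calc (4 : ℝ) = 4 * (n : ℝ) ^ 2 * (1 / n) ^ 2 := e.symm
    _ ≤ 4 * (n : ℝ) ^ 2 * sin x ^ 2 := by gcongr

end Summit.QuantumFields.YangMills.Theorems.N07AliasSumRobustBound

end
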